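import Literature.NumberTheory.Weil1964.LocalWeilIndexHilbertSymbol
import HarnessLib

/-!
# The sharp valuation law of an unramified binary norm form: `|a² − d b²| = max(|a|, |b|)²`

Topic `NumberTheory/QuadraticForms`; namespace `Literature.NumberTheory.QuadraticForms`.  KERNEL ONLY: theorems; no definition, no
named fact, no record, no `sorry`.  Generic non-archimedean local field `K` in the tree's `normAbs` ∕ `primePowBall` currency
(`|·| = normAbs K`, `𝔭^j = primePowBall K j = {|x| ≤ q^{−j}}`).

For `d ∈ K` a NON-SQUARE UNIT (`|d| = 1`, `¬ IsSquare d`) at ODD residue characteristic (`|2| = 1`), i.e. `K(√d)/K` the unramified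
quadratic extension, the norm form `N(a, b) = a² − d b²` satisfies the SHARP law ([Omeara1963, §63C Example 63:16] «`N_{E/F} Ė =
{α : ord α even}`», read quantitatively):

* §1 `normAbs_sq_sub_eq_one_of_not_isSquare` — `d` is a non-square RESIDUALLY: `|x² − d| = 1` for every `|x| ≤ 1` (if `x² ≡ d (𝔭)` then
  `d/x² ∈ 1 + 𝔭 ⊆ K²` by the local square theorem ★ `isSquare_one_add_of_mem_primePowBall`, [Omeara1963, 63:1b]);
* §2 **`normAbs_sq_sub_mul_sq`**: `|a² − d b²| = max(|a|, |b|)²` (anisotropy exponent ZERO — compare the qualitative ★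
  `LocalNormFormLattices.exists_anisotropy_const`);
* §3 box currency: `a² − d b² ∈ 𝔭^{2j} ↔ a, b ∈ 𝔭^j` (`sq_sub_mul_sq_mem_primePowBall_iff`), the ODD balls force the next even one
  (`mem_primePowBall_of_sq_sub_mul_sq_mem_odd`: `a² − d b² ∈ 𝔭^{2j−1} → a, b ∈ 𝔭^j`, since `|a² − d b²|` is an even power of `q`),
  and the contrapositive `sq_sub_mul_sq_notMem_primePowBall_odd`.

Consumer: cell `hodgecm-mathlib`, crux H413, P2 road δ (δ2 ∕ δ2-A: the `x′`-support law «`N⁰(x′) ∈ 𝔭^{−m} ⇒ x′ ∈ (𝔭^{⌈−m/2⌉})²`»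
and the unit value of `N⁰′` feeding ★ `SchwartzBruhatLatticeUncertainty` (δ1c)(δ1d)).  Nothing of the cited source is asserted.
HC_CM is proved only modulo the 7 printed citations until rung 0 closes; this file proves nothing about them.

## References
* [Omeara1963] O. T. O'Meara, *Introduction to quadratic forms* (1963), §63A Cor. 63:1b (local square theorem), §63C Example 63:16.
* [WeilBNT1967] A. Weil, *Basic Number Theory* (1967), Chap. II §1 (ultrametric `K`-norms).
-/

set_option autoImplicit false

open scoped NNReal
open Literature.NumberTheory.GaloisRepresentations.IsNonarchimedeanLocalField
open Literature.NumberTheory.Automorphic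

namespace Literature.NumberTheory.QuadraticForms

variable {K : Type*} [Field K] [ValuativeRel K] [TopologicalSpace K] [IsNonarchimedeanLocalField K]

/-! ## §1 A non-square unit is a non-square residually (odd residue characteristic) -/

/-- ultrametric equality: `|x + y| = |x|` when `|y| < |x|` (re-export of ★ `LocalFieldHaar.normAbs_add_eq_of_lt` in the order used here).
[cite: WeilBNT1967, Chap. II §1] -/
theorem normAbs_sub_eq_of_lt {x y : K} (h : normAbs K y < normAbs K x) : normAbs K (x - y) = normAbs K x := by
  rw [sub_eq_add_neg]
  exact LocalFieldHaar.normAbs_add_eq_of_lt (by rwa [normAbs_neg])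

/-- **a non-square unit is residually a non-square** at odd residue characteristic: `|x² − d| = 1` whenever `|x| ≤ 1`.
(If `|x² − d| < 1` then `|x| = 1` and `d/x² ∈ 1 + 𝔭` is a square by the local square theorem, so `d` is a square.)
[cite: Omeara1963, §63A Cor. 63:1b] -/
theorem normAbs_sq_sub_eq_one_of_not_isSquare {d : K} (hd : normAbs K d = 1) (hnsq : ¬ IsSquare d)
    (h2 : normAbs K (2 : K) = 1) {x : K} (hx : normAbs K x ≤ 1) : normAbs K (x ^ 2 - d) = 1 := by
  have hle : normAbs K (x ^ 2 - d) ≤ 1 := by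
    rw [sub_eq_add_neg]
    refine (normAbs_add_le_max _ _).trans (max_le ?_ ?_)
    · rw [map_pow]; exact pow_le_one₀ (by positivity) hx
    · rw [normAbs_neg, hd]
  refine le_antisymm hle (not_lt.mp fun hlt => hnsq ?_)
  -- `|x| = 1`: otherwise `|x²| < 1 = |d|` and `|x² − d| = |d| = 1`
  have hx1 : normAbs K x = 1 := by
    refine le_antisymm hx (not_lt.mp fun hxl => ?_)
    have : normAbs K (x ^ 2) < normAbs K d := by
      rw [map_pow, hd]; exact pow_lt_one₀ (by positivity) hxl two_ne_zero
    have h' : normAbs K (x ^ 2 - d) = normAbs K d := by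
      rw [show x ^ 2 - d = -(d - x ^ 2) by ring, normAbs_neg, normAbs_sub_eq_of_lt this]
    rw [h', hd] at hlt
    exact lt_irrefl _ hlt
  have hx0 : x ≠ 0 := fun h => by rw [h, map_zero] at hx1; exact zero_ne_one hx1
  have hx20 : x ^ 2 ≠ 0 := pow_ne_zero 2 hx0
  -- `d / x² − 1 = (d − x²)/x² ∈ 𝔭`, so `d/x² = 1 + h` is a square
  have htwo : (2 : K) ≠ 0 := fun h => by rw [h, map_zero] at h2; exact zero_ne_one h2
  have h20 : normAbs K (2 : K) = (residueFieldCard K : ℝ≥0)⁻¹ ^ (0 : ℤ) := by rw [zpow_zero, h2]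
  have hh : d / x ^ 2 - 1 ∈ primePowBall K (2 * 0 + 1) := by
    rw [mem_primePowBall_iff, show d / x ^ 2 - 1 = -(x ^ 2 - d) / x ^ 2 by field_simp; ring, map_div₀, normAbs_neg,
      map_pow, hx1, one_pow, div_one]
    -- `|x² − d| < 1` means `≤ q⁻¹` (the value group is `q^ℤ`)
    have hne : x ^ 2 - d ≠ 0 := fun h => hnsq ⟨x, by rw [← sq]; exact (sub_eq_zero.mp h).symm⟩
    obtain ⟨k, hk⟩ := exists_normAbs_eq_inv_zpow hne
    rw [hk] at hlt ⊢
    have hk1 : 1 ≤ k := by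
      by_contra hk0
      push Not at hk0
      have : (1 : ℝ≥0) ≤ ((residueFieldCard K : ℝ≥0)⁻¹) ^ k := by
        rw [← zpow_zero ((residueFieldCard K : ℝ≥0)⁻¹)]
        exact zpow_le_zpow_right_of_le_one₀ inv_residueFieldCard_pos inv_residueFieldCard_lt_one.le (by omega)
      exact absurd hlt (not_lt.mpr this)
    simpa using zpow_le_zpow_right_of_le_one₀ inv_residueFieldCard_pos inv_residueFieldCard_lt_one.le hk1
  obtain ⟨r, hr⟩ := Weil1964.isSquare_one_add_of_mem_primePowBall h20 htwo hh
  refine ⟨r * x, ?_⟩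
  have : d = (1 + (d / x ^ 2 - 1)) * x ^ 2 := by field_simp; ring
  rw [this, hr]; ring

/-! ## §2 The sharp law `|a² − d b²| = max(|a|, |b|)²` -/

/-- **THE SHARP UNRAMIFIED NORM LAW**: `|a² − d b²| = max(|a|, |b|)²` for `d` a non-square unit and `|2| = 1`
(`v(a² − d b²) = 2·min(v a, v b)`: the norm form of the unramified quadratic extension has anisotropy exponent `0`).
[cite: Omeara1963, §63C Example 63:16] -/
theorem normAbs_sq_sub_mul_sq {d : K} (hd : normAbs K d = 1) (hnsq : ¬ IsSquare d) (h2 : normAbs K (2 : K) = 1) (a b : K) :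
    normAbs K (a ^ 2 - d * b ^ 2) = max (normAbs K a) (normAbs K b) ^ 2 := by
  by_cases hb : b = 0
  · simp [hb, map_pow]
  have hb0 : normAbs K b ≠ 0 := by rwa [ne_eq, map_eq_zero]
  -- factor `a² − d b² = b² · ((a/b)² − d)`
  have hfac : a ^ 2 - d * b ^ 2 = b ^ 2 * ((a / b) ^ 2 - d) := by field_simp
  rw [hfac, map_mul, map_pow]
  rcases le_or_gt (normAbs K (a / b)) 1 with hle | hgt
  · -- `|a| ≤ |b|`: the residual lemma gives `|(a/b)² − d| = 1`
    rw [normAbs_sq_sub_eq_one_of_not_isSquare hd hnsq h2 hle, mul_one]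
    have hab : normAbs K a ≤ normAbs K b := by
      rwa [map_div₀, div_le_one₀ (pos_iff_ne_zero.mpr hb0)] at hle
    rw [max_eq_right hab]
  · -- `|a| > |b|`: `|(a/b)²| > 1 = |d|`, ultrametric equality
    have hgt' : normAbs K d < normAbs K ((a / b) ^ 2) := by
      rw [hd, map_pow]; exact one_lt_pow₀ hgt two_ne_zero
    rw [normAbs_sub_eq_of_lt hgt', map_pow, map_div₀, div_pow, mul_div_cancel₀ _ (pow_ne_zero 2 hb0)]
    have hab : normAbs K b ≤ normAbs K a := by
      rw [map_div₀, one_lt_div₀ (pos_iff_ne_zero.mpr hb0)] at hgt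
      exact hgt.le
    rw [max_eq_left hab]

/-! ## §3 Box currency -/

/-- `a² − d b² ∈ 𝔭^{2j} ↔ a ∈ 𝔭^j ∧ b ∈ 𝔭^j`. [cite: Omeara1963, §63C Example 63:16] -/
theorem sq_sub_mul_sq_mem_primePowBall_iff {d : K} (hd : normAbs K d = 1) (hnsq : ¬ IsSquare d) (h2 : normAbs K (2 : K) = 1)
    (a b : K) (j : ℤ) :
    a ^ 2 - d * b ^ 2 ∈ primePowBall K (2 * j) ↔ a ∈ primePowBall K j ∧ b ∈ primePowBall K j := by
  rw [mem_primePowBall_iff, mem_primePowBall_iff, mem_primePowBall_iff, normAbs_sq_sub_mul_sq hd hnsq h2,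
    show ((residueFieldCard K : ℝ≥0)⁻¹) ^ (2 * j) = (((residueFieldCard K : ℝ≥0)⁻¹) ^ j) ^ 2 by
      rw [mul_comm, zpow_mul, zpow_ofNat],
    pow_le_pow_iff_left₀ (by positivity) (by positivity) two_ne_zero, max_le_iff]

/-- **the odd balls force the next even one**: `a² − d b² ∈ 𝔭^{2j−1} → a, b ∈ 𝔭^j` (the absolute value of a norm is an EVEN
power of `q`). [cite: Omeara1963, §63C Example 63:16] -/
theorem mem_primePowBall_of_sq_sub_mul_sq_mem_odd {d : K} (hd : normAbs K d = 1) (hnsq : ¬ IsSquare d)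
    (h2 : normAbs K (2 : K) = 1) {a b : K} {j : ℤ} (h : a ^ 2 - d * b ^ 2 ∈ primePowBall K (2 * j - 1)) :
    a ∈ primePowBall K j ∧ b ∈ primePowBall K j := by
  rw [← sq_sub_mul_sq_mem_primePowBall_iff hd hnsq h2, mem_primePowBall_iff]
  rw [mem_primePowBall_iff, normAbs_sq_sub_mul_sq hd hnsq h2] at h
  rw [normAbs_sq_sub_mul_sq hd hnsq h2]
  -- `M := max |a| |b|` is `0` or `q^{−i}`; `M² ≤ q^{−(2j−1)}` forces `2i ≥ 2j − 1`, i.e. `i ≥ j`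
  set M := max (normAbs K a) (normAbs K b) with hM
  by_cases hM0 : M = 0
  · rw [hM0, zero_pow two_ne_zero]; positivity
  -- `M` is the absolute value of `a` or of `b`, whichever is larger, hence an integral power of `q⁻¹`
  have hMval : ∃ i : ℤ, M = ((residueFieldCard K : ℝ≥0)⁻¹) ^ i := by
    rcases le_total (normAbs K a) (normAbs K b) with hab | hab
    · have hMb : M = normAbs K b := max_eq_right hab
      have hb : b ≠ 0 := fun h0 => hM0 (by rw [hMb, h0, map_zero])
      obtain ⟨i, hi⟩ := exists_normAbs_eq_inv_zpow hb
      exact ⟨i, hMb.trans hi⟩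
    · have hMa : M = normAbs K a := max_eq_left hab
      have ha : a ≠ 0 := fun h0 => hM0 (by rw [hMa, h0, map_zero])
      obtain ⟨i, hi⟩ := exists_normAbs_eq_inv_zpow ha
      exact ⟨i, hMa.trans hi⟩
  obtain ⟨i, hi⟩ := hMval
  rw [hi, ← zpow_ofNat, ← zpow_mul] at h ⊢
  have hq0 := inv_residueFieldCard_pos (F := K)
  have hq1 := inv_residueFieldCard_lt_one (F := K)
  have hij : 2 * j - 1 ≤ i * (2 : ℕ) := (zpow_le_zpow_iff_right_of_lt_one₀ hq0 hq1).mp h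
  exact (zpow_le_zpow_iff_right_of_lt_one₀ hq0 hq1).mpr (by push_cast at hij ⊢; omega)

/-- contrapositive, as the consumer reads it: if NOT both `a, b ∈ 𝔭^{j+1}` then `a² − d b² ∉ 𝔭^{2j+1}`.
[cite: Omeara1963, §63C Example 63:16] -/
theorem sq_sub_mul_sq_notMem_primePowBall_odd {d : K} (hd : normAbs K d = 1) (hnsq : ¬ IsSquare d)
    (h2 : normAbs K (2 : K) = 1) {a b : K} {j : ℤ} (h : ¬ (a ∈ primePowBall K (j + 1) ∧ b ∈ primePowBall K (j + 1))) :
    a ^ 2 - d * b ^ 2 ∉ primePowBall K (2 * j + 1) := fun hmem =>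
  h (mem_primePowBall_of_sq_sub_mul_sq_mem_odd hd hnsq h2 (by rwa [show 2 * (j + 1) - 1 = 2 * j + 1 by ring]))

/-- unit values: `|a² − d b²| = 1` as soon as `a, b ∈ 𝒪` and one of them is a unit — e.g. `N(1, 0) = 1`; the «unit value on `𝒪²`»
input of ★ `SchwartzBruhatLatticeUncertainty.exists_mem_piPrimePowBall_mul_quadraticMap_add_sub_notMem`.
[cite: Omeara1963, §63C Example 63:16] -/
theorem normAbs_sq_sub_mul_sq_eq_one {d : K} (hd : normAbs K d = 1) (hnsq : ¬ IsSquare d) (h2 : normAbs K (2 : K) = 1)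
    {a b : K} (ha : normAbs K a ≤ 1) (hb : normAbs K b ≤ 1) (hab : normAbs K a = 1 ∨ normAbs K b = 1) :
    normAbs K (a ^ 2 - d * b ^ 2) = 1 := by
  rw [normAbs_sq_sub_mul_sq hd hnsq h2]
  have : max (normAbs K a) (normAbs K b) = 1 := le_antisymm (max_le ha hb) (by
    rcases hab with h | h
    · exact h.symm.le.trans (le_max_left _ _)
    · exact h.symm.le.trans (le_max_right _ _))
  rw [this, one_pow]

end Literature.NumberTheory.QuadraticForms
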